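import Mathlib
import HarnessLib
import Summits.HubbardSuperconductivity.HubbardSuperconductivity.Theorems.KLProgrammeKLRegimeTwoVolumeLipProfilesOfTowerRate
import Summits.HubbardSuperconductivity.HubbardSuperconductivity.Theorems.KLProgrammeKLRegimeTwoVolumeLipDiffDefsOwnFrames

/-!
# Route `KLProgramme` — crux K3 ENGINE (stmt-HubbardSuperconductivity-20437), stub (e) proof-input «(e)-D-ROWS», two-volume Lipschitz tower, OWN FRAMES:
# the weighted profile of the own-frame measured difference from E1's rate-decoupled measured arrays at the two volumes
# (seat hubbard-kl-k3c4-p1 g25, VL lane; `--supports` 20437; located #8 option (A), g25/REKEY-A.md file 4)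

`…TwoVolumeLipProfilesOfTowerRate` (p722567) reads the glued-weight profiles of the glued coarse input, the fine input and their COMMON-frame difference off E1's arrays
`klTowerMeasWtAt V … K d k j_w m`; its one-volume lemmas are frame-generic.  Here the one two-volume lemma is re-keyed with own frames:

* **`inputDiff₂_wt_profile_le_towerMeasWtAt`** — `Σ_{Y : Y_j = x} ‖kernel (klLipInputDiff₂ L b M β U μ K₁ K₂ d k) m Y‖ · klGluedWt … ≤ ε·(klTowerMeasWtAt (bL) … K₂ d k j_w m +
  klTowerMeasWtAt L … K₁ d k j_w m)` (triangle over `fine[K₂] − glue coarse[K₁]`, each bounded by its own volume's array).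
Pure bookkeeping; nothing about the model is asserted; nothing asserts the (D) rows, (e), VL, K3 or superconductivity.
-/

noncomputable section

namespace Summit.HubbardSuperconductivity.HubbardSuperconductivity.Theorems.TwoVolumeLip

set_option linter.dupNamespace false -- summit = problem name (single-conjunct summit), D-0017

open Finset Literature.MathematicalPhysics.QuantumLattice GrassmannAlgebra Literature.Probability.LatticeModels
open Literature.MathematicalPhysics.QuantumLattice.FermiRG
open Summit.HubbardSuperconductivity.HubbardSuperconductivity.Theorems.KLRegimeSplit
open Summit.HubbardSuperconductivity.HubbardSuperconductivity.Theorems.KLProgrammeLegKernels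
open Summit.HubbardSuperconductivity.HubbardSuperconductivity.Theorems.DispersionFlow
open Summit.HubbardSuperconductivity.HubbardSuperconductivity.Theorems.EngineV8
open Summit.HubbardSuperconductivity.HubbardSuperconductivity.Theorems.TwoVolumeSource
open Summit.HubbardSuperconductivity.HubbardSuperconductivity.Theorems.TwoVolumeDefect

variable {L b M : ℕ} [NeZero L] [NeZero (b * L)]

/-- **`hND` with own frames**: the glued-weight profile of the own-frame measured difference is at most `ε·(fine array at K₂ + coarse array at K₁)`. -/
theorem inputDiff₂_wt_profile_le_towerMeasWtAt [NeZero M] {β : ℝ} (hβ : 0 ≤ β) (U μ : ℝ) (K₁ K₂ : TrigPolyC4v) (d k jw : ℕ) {m : ℕ} (j : Fin m)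
    (x : SpaceTimeIdx (b * L) M × SectorLeg (sectorCount (d * k - 1))) :
    ∑ Y ∈ univ.filter (fun Y : Fin m → SpaceTimeIdx (b * L) M × SectorLeg (sectorCount (d * k - 1)) => Y j = x),
        ‖kernel ℂ (klLipInputDiff₂ L b M β U μ K₁ K₂ d k) m Y‖ * klGluedWt L b M β jw (sectorCount (d * k - 1)) (univ.image Y) ≤
      imagTimeWeight β M * (klTowerMeasWtAt (b * L) M β U μ K₂ d k jw m + klTowerMeasWtAt L M β U μ K₁ d k jw m) := by
  rw [klLipInputDiff₂_def, mul_add]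
  exact sum_pinned_wt_norm_kernel_sub_le _ _ j x _ (fun S => (isTreeWeight_klGluedWt (L := L) (b := b) (M := M) hβ jw (sectorCount (d * k - 1))).nonneg S)
    (fine_gluedWt_profile_le_towerMeasWtAt hβ U μ K₂ d k jw j x) (glue_wt_profile_le_towerMeasWtAt hβ U μ K₁ d k jw j x)

end Summit.HubbardSuperconductivity.HubbardSuperconductivity.Theorems.TwoVolumeLip

end
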